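import Summits.BirchSwinnertonDyer.BirchSwinnertonDyer.Theorems.ErratumRoadFiveIMCDivClassicalBLambdaMatching
import Summits.BirchSwinnertonDyer.BirchSwinnertonDyer.Theorems.ErratumRoadFiveOpenInputNotRamBDPFrameDescentStub
import HarnessLib

/-!
# Route `ErratumRoadFive` (K2), the CLASSICAL-data residuals (items 19282 `OpenInputNotRam`, 19702, 19703; deciding
# stub shape = the oriented value-free atom (2.4)∃♭ᴮ `P2.IMCDivSomeFrameOnTreeB W p`) — ROAD B12 «λ-MATCHING
# TRANSFER» WITHOUT ITS FRAME HYPOTHESIS: the atom from TWO REFEREED NAMED FACTS + UB + INV, on EVERY pair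

Cell `bsd-stepL` (run/shared/lean/pub/bsd-stepL/), seat `bsd-stepL-bdp` (prover g18, 2026-08-27).
`--supports stmt-BirchSwinnertonDyer-19282 --as helper`. THEOREMS ONLY (no definition, no named fact, no `sorry`).
Memo: HOME/proof/PROOF-BDP.md §37 (ROAD B12, bdp g17) and §38 (bdp g18: brick (ε3) decomposed).

bdp g17's `P2.imcDivSomeFrameOnTreeB_of_unrFrame_of_ratUpperBound_of_invariantsMatch` (p507771, Theses-free) derives
the atom from THREE stub shapes over the atom's own binders: FRAME (an `R₀`-frame `(Ω_K ≠ 0, Ω_p ∈ R₀ˣ, L ∈ R₀⟦T⟧)`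
with Castella's interpolation property at `(ι', 𝔭_{ι'})`), UB (one RATIONAL Euler-system divisibility at every X-slot
`𝔭bar ≠ 𝔭_{ι'}`) and INV (matching first-unit-coefficient invariants). Its docstring sources FRAME «at `p ≥ 5`» from
A206 ∕ the JIMJ18 display, i.e. from Castella 2018 Thm. 3.1, which stands under «square-free `N`». THIS FILE REMOVES
FRAME AS A HYPOTHESIS ON EVERY PAIR (any conductor, any odd `p ∥ N`): nram2 g2's general-`p` `R₀`-DESCENT
`exists_isBDPLFunction_of_hsieh2014_unrPeriod_of_bdp2013` (p471323, `ErratumRoadFiveOpenInputNotRamBDPFrameDescentStub`; descent p470699)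
supplies the frame at every classical datum from the TWO REFEREED named facts
`hsieh2014_exists_anticyclotomicPAdicLFunction_unrPeriod` (Hsieh, Doc. Math. 19 (2014) Thm. 5.6, period in `𝒲^×`)
and `bertoliniDarmonPrasanna2013_centralValue_reciprocity` (BDP, Duke 162 (2013) Thm. 5.5 ∕ (5.1.16)). So ROAD B12
at the classical atoms reads: **(2.4)∃♭ᴮ ⟸ {two PUB facts, UB, INV}** — the deciding unprinted content is exactly
UB (brick (ε3) of §37.2: a `Λ`-adic Kolyvagin bound in Heegner-point currency + the explicit reciprocity law at
`p ∥ N` + a duality passage, §38) and INV (bricks (ε1), (ε2), (ε4)).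

* §1 `P2.unrFrame_of_hsieh2014_unrPeriod_of_bdp2013` — the FRAME binder of p507771 VERBATIM, from the two facts.
  Plumbing: `p ∣ N`, `p² ∤ N` from `Mult W p` (inside `ClassX11b`); `p` splits in the strict-Heegner `K`, so
  `𝔭_{ι'} := primeOfEmbeddingDatum p ι' w₀.embedding` has degree one (`degreeOne_primeOfEmbeddingDatum`) and is
  induced by `ι'` at every infinite place (`forall_mem_primeOfEmbeddingDatum_iff`); `f := f_{Dt}`.
* §2 **`P2.imcDivSomeFrameOnTreeB_of_hsieh2014_of_bdp2013_of_ratUpperBound_of_invariantsMatch`** — the atom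
  `P2.IMCDivSomeFrameOnTreeB W p` from the two facts + UB + INV (the UB ∕ INV binders of p507771 VERBATIM).

NOT Theses-free (the descent chain imports desc3-p1's `ClassRecordThree*` files, whose closure contains the three
route files): a HELPER, not citable inline in a `closes` block. HONEST FRAMING: CONDITIONAL theorems (hypotheses =
two refereed named facts carried by name + the two open shapes UB ∕ INV); nothing is discharged beyond FRAME,
nothing booked or re-labelled (T7); BSD is not proved for any class; X11b stays CONSTRUCTION-SHAPED; UB at `p ∥ N`
is unprinted at `p = 3` and PRE-grade ∕ print-modulo-hypotheses at `p ≥ 5` (§38); INV needs the `p ∣ N` transfers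
(ε2) and a partner (ε4). What this is NOT: not a statement about THE `L_p(f)` of Castella (the frame is
∃-quantified), not a closure of 19282 ∕ 19702 ∕ 19703.

References: [Hsieh2014] Thm. 1 ∕ Thm. 5.6 (arXiv:1112.1580 pp. 3–4, 23); [BertoliniDarmonPrasanna2013] Thm. 5.5,
(5.1.16); [Castella2018] Thm. 3.1 (arXiv:1704.06608 p. 9); [Castella2018Erratum] (2.4) (p. 4); [Washington1997]
Prop. 7.2, §13.2; [EmertonPollackWeston2006] Thm. 1; [BurungaleCastellaSkinner2025] Thm. 1.2.4.
-/

set_option autoImplicit false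
set_option linter.dupNamespace false

noncomputable section

open scoped Classical NumberField

open WeierstrassCurve NumberField IsDedekindDomain Field PowerSeries
open Literature.NumberTheory.EllipticCurves Literature.NumberTheory.EllipticCurves.GreenbergSelmer
open Literature.NumberTheory.EllipticCurves.ModularForms
open Literature.NumberTheory.EllipticCurves.Rank1Residual
open Literature.NumberTheory.EllipticCurves.Castella2018
open Literature.NumberTheory.GaloisRepresentations Literature.NumberTheory.GaloisCohomology
open Summit.BirchSwinnertonDyer.Rank1Residual.X11b.AcSelmer
open Summit.BirchSwinnertonDyer.Rank1Residual.X11b.Halves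
open Summit.BirchSwinnertonDyer.Rank1Residual.X1.KellerYinHalves
open Summit.BirchSwinnertonDyer.BirchSwinnertonDyer.Theorems

namespace Summit.BirchSwinnertonDyer.Rank1Residual.X11b

variable {W : WeierstrassCurve ℚ} [W.IsElliptic] {p : ℕ} [Fact p.Prime]

/-! ### §1 FRAME from the two refereed named facts, on every pair -/

/-- **The FRAME binder of ROAD B12 (p507771) on EVERY pair, from Hsieh 2014 Thm. 5.6 + BDP13 Thm. 5.5.** At every
classical X11b datum (`p ≥ 5`, `ρ̄` onto, `K` strict Heegner of odd discriminant, `Dt`, `P`, anticyclotomic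
`(κ, γ)`, an embedding datum `(ι', w₀)` with a reading `(P', e)`), an `R₀`-frame `(Ω_K ≠ 0, Ω_p ∈ R₀ˣ, L ∈ R₀⟦T⟧)`
with Castella's interpolation property at `(ι', 𝔭_{ι'})` for `f_{Dt}` EXISTS — by nram2's general-`p` descent
`exists_isBDPLFunction_of_hsieh2014_unrPeriod_of_bdp2013` (no `Squarefree N`). The binders `Surj`, `¬ p ∣ d_K`,
`¬ p ∣ #𝓞_K^×`, `L(E^{d_K},1) ≠ 0`, `P`, `P'`, `e` are idle. CONDITIONAL on the two named facts.
[cite: Hsieh2014, Thm. 1 and Thm. 5.6 (arXiv:1112.1580 pp. 3–4, 23)]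
[cite: BertoliniDarmonPrasanna2013, Thm. 5.5 and (5.1.16)] [cite: Castella2018, Thm. 3.1 (arXiv:1704.06608 p. 9)] -/
theorem P2.unrFrame_of_hsieh2014_unrPeriod_of_bdp2013
    (hH : hsieh2014_exists_anticyclotomicPAdicLFunction_unrPeriod)
    (hR : bertoliniDarmonPrasanna2013_centralValue_reciprocity) :
    ∀ (N : ℕ) [NeZero N] (K : Type) [Field K] [NumberField K]
      (Dt : ModularParametrizationData W N) (H : HeegnerDatum N (NumberField.discr K)) (ι : K →+* ℂ)
      (P : (W.baseChange K).toAffine.Point),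
      ClassX11b W p → 5 ≤ p → Surj W p → W.conductorNorm ℤ = N → IsImaginaryQuadratic K →
      Odd (NumberField.discr K) → ¬ (p : ℤ) ∣ NumberField.discr K → ¬ p ∣ Units.torsionOrder K →
      SatisfiesHeegnerHypothesis N K →
      (W.quadraticTwist (NumberField.discr K : ℚ)).entireLFunction 1 ≠ 0 →
      WeierstrassCurve.Affine.Point.map ι.toRatAlgHom P = heegnerPointComplex Dt H →
      ¬ (p : ℤ) ∣ Dt.c → ¬ IsOfFinAddOrder P →
      ∀ (κ : ZpExtension K p), κ.IsAnticyclotomic →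
        ∀ (γ : Field.absoluteGaloisGroup K) [Fact (κ.IsTopGenerator γ)]
          (ι' : PadicAlgCl p ≃+* ℂ) (w₀ : InfinitePlace K) (P' : (W.baseChange K).toAffine.Point),
          WeierstrassCurve.Affine.Point.map w₀.embedding.toRatAlgHom P' = heegnerPointComplex Dt H →
          ∀ (e : K →+* ℚ_[p]),
            (∀ k : 𝓞 K, k ∈ (primeOfEmbeddingDatum p ι' w₀.embedding).asIdeal ↔ ‖e (k : K)‖ < 1) →
            ∃ (ΩK : ℂ) (Ωp : (unrIntegers p)ˣ) (L : UnrSeries p), ΩK ≠ 0 ∧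
              IsBDPLFunction ι' (primeOfEmbeddingDatum p ι' w₀.embedding) κ γ Dt.f ΩK
                ((Ωp : unrIntegers p) : ℂ_[p]) L := by
  intro N _ K _ _ Dt H ι P hX h5 _hs hN hK hodd _hpd _hμ hHN _hLt _hP _hc _hPinf κ hκ γ hγ ι' w₀ P' _hP'
    e _he
  have hp2 : p ≠ 2 := by omega
  have hmult : Mult W p := hX.2.2.1
  have hpN : p ∣ N := hN ▸ dvd_conductorNorm_of_mult hmult
  have hp2N : ¬ p ^ 2 ∣ N := hN ▸ not_sq_dvd_conductorNorm_of_mult W p hmult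
  -- `p ∣ N` splits in the strict-Heegner field `K`, so `𝔭_{ι'}` has degree one
  have hsplit : SplitsIn K p := hHN p Fact.out hpN
  obtain ⟨he1, hf1⟩ := degreeOne_primeOfEmbeddingDatum p ι' hK.1 hsplit w₀.embedding
  exact exists_isBDPLFunction_of_hsieh2014_unrPeriod_of_bdp2013 hH hR hp2 ι' W K
    (primeOfEmbeddingDatum p ι' w₀.embedding) κ γ Dt.isNewformOf hN hpN hp2N hK hodd hHN
    (natCast_mem_primeOfEmbeddingDatum p ι' w₀.embedding) he1 hf1
    (forall_mem_primeOfEmbeddingDatum_iff p ι' hK w₀) hκ hγ.out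

/-! ### §2 The atom from the two facts + UB + INV -/

/-- **ROAD B12 at the classical atoms WITHOUT the FRAME hypothesis: (2.4)∃♭ᴮ `P2.IMCDivSomeFrameOnTreeB W p` ⟸
{Hsieh 2014 Thm. 5.6, BDP13 Thm. 5.5} + UB + INV** — the UB ∕ INV binders of p507771 VERBATIM (for every
`R₀`-frame at `(ι', 𝔭_{ι'})` and every X-slot `𝔭bar ∋ p`, `𝔭bar ≠ 𝔭_{ι'}`: ONE rational Euler-system
divisibility `∃ k, p^k·L ∈ Ch(X_ac 𝔭bar)·R₀⟦T⟧`, resp. matching first unit coefficients of a generator of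
`Ch(X_ac 𝔭bar)` and of `L`). Composition: §1 feeds p507771's FRAME. CONDITIONAL on the two named facts and the two
open shapes; the deciding unprinted content of items 19282 ∕ 19702 ∕ 19703 along ROAD B12 is thereby UB + INV
exactly. Nothing booked. [cite: Castella2018Erratum, (2.4) (p. 4) (the atom's display)]
[cite: Hsieh2014, Thm. 5.6] [cite: BertoliniDarmonPrasanna2013, Thm. 5.5]
[cite: Washington1997, §7.1 Prop. 7.2 and §13.2] [cite: EmertonPollackWeston2006, Thm. 1 (mechanism)]
[cite: BurungaleCastellaSkinner2025, Thm. 1.2.4 (the partner's equality at p ≥ 5)] -/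
theorem P2.imcDivSomeFrameOnTreeB_of_hsieh2014_of_bdp2013_of_ratUpperBound_of_invariantsMatch
    (hH : hsieh2014_exists_anticyclotomicPAdicLFunction_unrPeriod)
    (hR : bertoliniDarmonPrasanna2013_centralValue_reciprocity)
    (hUB : ∀ (N : ℕ) [NeZero N] (K : Type) [Field K] [NumberField K]
      (Dt : ModularParametrizationData W N) (H : HeegnerDatum N (NumberField.discr K)) (ι : K →+* ℂ)
      (P : (W.baseChange K).toAffine.Point),
      ClassX11b W p → 5 ≤ p → Surj W p → W.conductorNorm ℤ = N → IsImaginaryQuadratic K →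
      Odd (NumberField.discr K) → ¬ (p : ℤ) ∣ NumberField.discr K → ¬ p ∣ Units.torsionOrder K →
      SatisfiesHeegnerHypothesis N K →
      (W.quadraticTwist (NumberField.discr K : ℚ)).entireLFunction 1 ≠ 0 →
      WeierstrassCurve.Affine.Point.map ι.toRatAlgHom P = heegnerPointComplex Dt H →
      ¬ (p : ℤ) ∣ Dt.c → ¬ IsOfFinAddOrder P →
      ∀ (κ : ZpExtension K p), κ.IsAnticyclotomic →
        ∀ (γ : Field.absoluteGaloisGroup K) [Fact (κ.IsTopGenerator γ)]
          (ι' : PadicAlgCl p ≃+* ℂ) (w₀ : InfinitePlace K) (P' : (W.baseChange K).toAffine.Point),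
          WeierstrassCurve.Affine.Point.map w₀.embedding.toRatAlgHom P' = heegnerPointComplex Dt H →
          ∀ (e : K →+* ℚ_[p]),
            (∀ k : 𝓞 K, k ∈ (primeOfEmbeddingDatum p ι' w₀.embedding).asIdeal ↔ ‖e (k : K)‖ < 1) →
            ∀ (ΩK : ℂ) (Ωp : (unrIntegers p)ˣ) (L : UnrSeries p), ΩK ≠ 0 →
              IsBDPLFunction ι' (primeOfEmbeddingDatum p ι' w₀.embedding) κ γ Dt.f ΩK
                ((Ωp : unrIntegers p) : ℂ_[p]) L →
              ∀ (𝔭bar : HeightOneSpectrum (𝓞 K)), ((p : ℕ) : 𝓞 K) ∈ 𝔭bar.asIdeal →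
                𝔭bar ≠ primeOfEmbeddingDatum p ι' w₀.embedding →
                ∃ k : ℕ, C (((p : ℕ) : unrIntegers p) ^ k) * L ∈
                  (XAc.charIdeal (W.baseChange K) p κ 𝔭bar ∅ γ).map (PowerSeries.map (toUnr p)))
    (hINV : ∀ (N : ℕ) [NeZero N] (K : Type) [Field K] [NumberField K]
      (Dt : ModularParametrizationData W N) (H : HeegnerDatum N (NumberField.discr K)) (ι : K →+* ℂ)
      (P : (W.baseChange K).toAffine.Point),
      ClassX11b W p → 5 ≤ p → Surj W p → W.conductorNorm ℤ = N → IsImaginaryQuadratic K →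
      Odd (NumberField.discr K) → ¬ (p : ℤ) ∣ NumberField.discr K → ¬ p ∣ Units.torsionOrder K →
      SatisfiesHeegnerHypothesis N K →
      (W.quadraticTwist (NumberField.discr K : ℚ)).entireLFunction 1 ≠ 0 →
      WeierstrassCurve.Affine.Point.map ι.toRatAlgHom P = heegnerPointComplex Dt H →
      ¬ (p : ℤ) ∣ Dt.c → ¬ IsOfFinAddOrder P →
      ∀ (κ : ZpExtension K p), κ.IsAnticyclotomic →
        ∀ (γ : Field.absoluteGaloisGroup K) [Fact (κ.IsTopGenerator γ)]
          (ι' : PadicAlgCl p ≃+* ℂ) (w₀ : InfinitePlace K) (P' : (W.baseChange K).toAffine.Point),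
          WeierstrassCurve.Affine.Point.map w₀.embedding.toRatAlgHom P' = heegnerPointComplex Dt H →
          ∀ (e : K →+* ℚ_[p]),
            (∀ k : 𝓞 K, k ∈ (primeOfEmbeddingDatum p ι' w₀.embedding).asIdeal ↔ ‖e (k : K)‖ < 1) →
            ∀ (ΩK : ℂ) (Ωp : (unrIntegers p)ˣ) (L : UnrSeries p), ΩK ≠ 0 →
              IsBDPLFunction ι' (primeOfEmbeddingDatum p ι' w₀.embedding) κ γ Dt.f ΩK
                ((Ωp : unrIntegers p) : ℂ_[p]) L →
              ∀ (𝔭bar : HeightOneSpectrum (𝓞 K)), ((p : ℕ) : 𝓞 K) ∈ 𝔭bar.asIdeal →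
                𝔭bar ≠ primeOfEmbeddingDatum p ι' w₀.embedding →
                ∃ (g : IwasawaAlgebra p) (n : ℕ),
                  XAc.charIdeal (W.baseChange K) p κ 𝔭bar ∅ γ = Ideal.span {g} ∧
                  (‖((coeff n (PowerSeries.map (toUnr p) g) : unrIntegers p) : ℂ_[p])‖ = 1 ∧
                    ∀ i < n, ‖((coeff i (PowerSeries.map (toUnr p) g) : unrIntegers p) : ℂ_[p])‖ < 1) ∧
                  (‖((coeff n L : unrIntegers p) : ℂ_[p])‖ = 1 ∧
                    ∀ i < n, ‖((coeff i L : unrIntegers p) : ℂ_[p])‖ < 1)) :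
    P2.IMCDivSomeFrameOnTreeB W p :=
  P2.imcDivSomeFrameOnTreeB_of_unrFrame_of_ratUpperBound_of_invariantsMatch
    (P2.unrFrame_of_hsieh2014_unrPeriod_of_bdp2013 hH hR) hUB hINV

end Summit.BirchSwinnertonDyer.Rank1Residual.X11b

end
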